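import Summits.AnomalousDissipation.AnomalousDissipation.Theorems.TwoAndHalfDTwohalfdThesisStubNonselectiveNoGo
import Summits.AnomalousDissipation.AnomalousDissipation.Theorems.TwoAndHalfDTwohalfdThesisStrainGateEnstrophy
import Summits.AnomalousDissipation.AnomalousDissipation.Theorems.TwoAndHalfDTwohalfdThesisStubFixedViscosityEnvelope
import Summits.AnomalousDissipation.AnomalousDissipation.Theorems.ScalarAnomalySteadySourceFormal.Negative.ScalarTimeShift
import Literature.Analysis.FluidPDE.ZerothLawProofs
import Literature.Analysis.Calculus.CutoffDataEnergy

/-!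
# Q6 `stub_torqueColdStartDiverges` — the Pr = 1 splitting: the torque cold start diverges
# (line `Sketch`, crux stmt-AnomalousDissipation-0206)

Registered stub of the line `Sketch` (duhamel-release) for the crux
`Summit.AnomalousDissipation.AnomalousDissipation.Theses.TwoAndHalfD.TwohalfdThesis`
(stmt-AnomalousDissipation-0206), section Q (SELECTIVITY OF THE WITNESS'S MIXING) of the skeleton
`Cruxes/TwohalfdThesis/Lines/Sketch.lean`.  The line writes the sourced third component of a witness as the
COLD START of the pattern `h` over the planar flow; its variance stays `≤ (s₀+M)²‖h‖²` (D1
`stub_duhamelVariance`).  At Prandtl number one the planar vorticity is the solution of the SAME equation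
sourced by the torque pattern `curl g` (Q1 `stub_vorticityEquation`), and this file proves that the cold
start of `curl g` over the same flow behaves in the opposite way:

* `enstrophy_le_torqueColdStartVariance` — ONE FLOW: for a classical solution of the steadily forced planar
  Navier–Stokes system (`ν > 0`, smooth mean-zero `g`) and any classical cold start `θ` of `curl g` from time
  `0`, the honest `limsup` mean enstrophy is at most the cold start's `limsup` mean variance,
  `⟨‖∇v‖₂²⟩ ≤ ⟨‖θ‖²⟩`: the vorticity minus the cold start is the unforced release of `ω(0)` (mean zero,
  Q3 (i)), which dies at fixed `ν` (`stub_fixedViscosityEnvelope`), and `‖∇v‖₂² = ‖ω‖₂²` (Q3 (ii)).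
* `stub_torqueColdStartDiverges` — THE FAMILY STATEMENT (registered): along a family as in W (classical
  releases of `h` with a uniform integrable envelope after `s₀`, Green–Kubo floor `ε > 0`; neither the energy
  ceiling nor `ν_j → 0` is assumed) there are `κ₀ > 0`, `a > 0`, `b` with
  `⟨‖θ‖²⟩ ≥ (a·log(1/ν_j) − b)²` for every member with `ν_j ≤ κ₀`, `a·log(1/ν_j) ≥ b` and every torque
  cold start `θ` over it — G5 `stub_witnessEnstrophyFloor` composed with the one-flow comparison.
So over the same witness flow the `h`-scalar SATURATES while the torque scalar's mean variance DIVERGES like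
`log²(1/ν_j)`: the sharpest form of selectivity, with no envelope language on the torque side.
Supports stmt-AnomalousDissipation-0206. [folklore: Crippa–De Lellis 2008 / Seis 2022 (log gate); Majda–Bertozzi 2002 §2.1]
-/

noncomputable section

-- the summit path `AnomalousDissipation/AnomalousDissipation` duplicates a namespace component
set_option linter.dupNamespace false

namespace Summit.AnomalousDissipation.AnomalousDissipation.Theorems.TwohalfdThesis

open MeasureTheory Set Filter Topology
open scoped ENNReal NNReal InnerProductSpace
open Literature.Analysis.FunctionSpaces Literature.Analysis.FluidPDE
open Summit.AnomalousDissipation.AnomalousDissipation.Theorems.TwohalfdNeg.QuietOfSubLog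

/-- Local notation: the flat two-torus. -/
local notation "𝕋²" => UnitAddTorus (Fin 2)
/-- Local notation: planar velocity values. -/
local notation "E²" => EuclideanSpace ℝ (Fin 2)

/-! ## Elementary bookkeeping -/

/-- `∫ (f + g)² ≤ (1 + η) ∫ f² + (1 + η⁻¹) ∫ g²` for smooth `f g` on the torus and `η > 0` (Young's inequality
`Literature.Analysis.Calculus.add_sq_le_weighted` under the integral). [folklore] -/
theorem tcs_scalarL2Sq_add_le {η : ℝ} (hη : 0 < η) {f g : 𝕋² → ℝ} (hf : Torus.IsSmooth f)
    (hg : Torus.IsSmooth g) :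
    Torus.scalarL2Sq (fun x => f x + g x) ≤
      (1 + η) * Torus.scalarL2Sq f + (1 + η⁻¹) * Torus.scalarL2Sq g := by
  unfold Torus.scalarL2Sq
  rw [← integral_const_mul, ← integral_const_mul,
    ← integral_add (((hf.memLp 2).integrable_sq).const_mul _) (((hg.memLp 2).integrable_sq).const_mul _)]
  exact integral_mono ((hf.add hg).memLp 2).integrable_sq
    ((((hf.memLp 2).integrable_sq).const_mul _).add (((hg.memLp 2).integrable_sq).const_mul _))
    fun x => Literature.Analysis.Calculus.add_sq_le_weighted hη (f x) (g x)

/-- The variance of a classical (forced or unforced) scalar is continuous in time on `[0, ∞)` when the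
scalar is jointly smooth there. [folklore] -/
theorem tcs_continuousOn_scalarL2Sq {θ : ℝ → 𝕋² → ℝ} (hθ : Torus.IsSmoothSpaceTimeOn (Ici 0) θ) :
    ContinuousOn (fun t => Torus.scalarL2Sq (θ t)) (Ici 0) := by
  refine ((hθ.mul hθ).continuousOn_integral (convex_Ici 0)).congr fun t _ => ?_
  simp only [Torus.scalarL2Sq, sq]

/-- Running means of a function bounded by a constant `K ≥ 0` on `(0, ∞)` are eventually `≤ K`. [folklore] -/
theorem tcs_isBoundedUnder_timeMean_of_le_const {r : ℝ → ℝ} {K : ℝ} (hK : 0 ≤ K)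
    (hle : ∀ t, 0 < t → r t ≤ K) : IsBoundedUnder (· ≤ ·) atTop (timeMean r) := by
  refine isBoundedUnder_timeMean_of_le (g := fun _ => K) (fun _ => hK)
    (fun T _ => integrableOn_const (hs := measure_Ioc_lt_top.ne)) hle ⟨K, ?_⟩
  rw [eventually_map]
  filter_upwards [eventually_gt_atTop (0 : ℝ)] with T hT
  unfold timeMean
  rw [intervalIntegral.integral_const, smul_eq_mul, sub_zero, ← mul_assoc, inv_mul_cancel₀ hT.ne', one_mul]

/-! ## One flow: mean enstrophy ≤ mean variance of the torque cold start -/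

/-- **Mean enstrophy is dominated by the torque cold start's mean variance (one flow, Pr = 1).**  Let
`(v, p)` be a classical solution of the planar Navier–Stokes system on `[0, ∞) × T²` with `ν > 0` and steady
smooth mean-zero force `g`, and `θ` a classical solution of `∂ₜθ + v·∇θ = νΔθ + curl g` on `[0, ∞)` with
`θ(0) = 0` (a cold start of the torque pattern).  Then `⟨‖∇v‖₂²⟩ ≤ ⟨‖θ‖²⟩` (honest `limsup` running
means).  PROOF: the vorticity `ω` solves the same sourced equation (Q1), so `R := ω − θ` is the unforced
release of `ω(0)` (mean zero, Q3 (i)) and `‖R(t)‖² ≤ e^{−8π²νt}‖ω(0)‖²` (`stub_fixedViscosityEnvelope`);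
`‖ω(t)‖² ≤ (1+η)‖θ(t)‖² + (1+η⁻¹)‖R(t)‖²`, Cesàro means (`longTimeAvgSup_le_add_of_le_add`, the transient's
mean vanishes by `envSrc_longTimeAvgSup_le_of_transient`), `‖∇v‖₂² = ‖ω‖₂²` (Q3 (ii)), and `η ↓ 0`. [folklore] -/
theorem enstrophy_le_torqueColdStartVariance {ν : ℝ} {g : 𝕋² → E²} {v : ℝ → 𝕋² → E²} {p : ℝ → 𝕋² → ℝ}
    {θ : ℝ → 𝕋² → ℝ} (hν : 0 < ν) (hg : Torus.IsSmooth g) (hgz : Torus.HasZeroMean g)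
    (hNS : Torus.IsClassicalNSSolutionOn (Ici 0) ν (fun _ => g) v p)
    (hθ : Torus.IsClassicalScalarTransportForcedOn (Ici 0) ν v
      (fun _ x => Torus.partialDeriv 0 g x 1 - Torus.partialDeriv 1 g x 0) θ)
    (hθ0 : θ 0 = fun _ => (0 : ℝ)) :
    longTimeAvgSup (fun t => (Torus.eGradNormSq (v t)).toReal) ≤
      longTimeAvgSup (fun t => Torus.scalarL2Sq (θ t)) := by
  -- the vorticity and the transient
  set ω : ℝ → 𝕋² → ℝ := fun t x => Torus.partialDeriv 0 (v t) x 1 - Torus.partialDeriv 1 (v t) x 0 with hωdef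
  have hω : Torus.IsClassicalScalarTransportForcedOn (Ici 0) ν v
      (fun _ x => Torus.partialDeriv 0 g x 1 - Torus.partialDeriv 1 g x 0) ω :=
    stub_vorticityEquation ν g v p hg hNS
  have hω0s : Torus.IsSmooth (ω 0) := hω.smooth_scalar.isSmooth_slice (mem_Ici.2 le_rfl)
  have hω0m : Torus.HasZeroMean (ω 0) :=
    stub_planarCurlTools.1 (v 0) (hNS.smooth_velocity.isSmooth_slice (mem_Ici.2 le_rfl))
  set R : ℝ → 𝕋² → ℝ := fun t x => ω t x - θ t x with hRdef
  have hR : Torus.IsClassicalScalarTransportOn (Ici 0) ν v R :=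
    Summit.AnomalousDissipation.AnomalousDissipation.Theorems.ScalarAnomalySteadySourceFormal.Negative.forced_sub_forced
      (uniqueDiffOn_Ici 0) hω hθ
  have hR0 : R 0 = ω 0 := by
    funext x
    simp [hRdef, hθ0]
  have hRdec := stub_fixedViscosityEnvelope ν 0 v (ω 0) R hν hω0s hω0m hR hR0
  -- the three observables
  set K₀ : ℝ := Torus.scalarL2Sq (ω 0) with hK₀
  have hK₀0 : 0 ≤ K₀ := Torus.scalarL2Sq_nonneg _
  set u : ℝ → ℝ := fun t => Torus.scalarL2Sq (ω t) with hudef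
  set w : ℝ → ℝ := fun t => Torus.scalarL2Sq (θ t) with hwdef
  set r : ℝ → ℝ := fun t => Torus.scalarL2Sq (R t) with hrdef
  have hu0 : ∀ t, 0 ≤ u t := fun t => Torus.scalarL2Sq_nonneg _
  have hw0 : ∀ t, 0 ≤ w t := fun t => Torus.scalarL2Sq_nonneg _
  have hr0 : ∀ t, 0 ≤ r t := fun t => Torus.scalarL2Sq_nonneg _
  -- the transient is dominated by `K₀ e^{-ct}` on `[0, ∞)`, hence by `K₀`
  set c : ℝ := 8 * Real.pi ^ 2 * ν with hcdef
  have hc : 0 < c := by positivity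
  have hrle : ∀ t, 0 ≤ t → r t ≤ K₀ * Real.exp (-c * t) := by
    intro t ht
    have h1 := hRdec t ht
    rw [sub_zero] at h1
    simpa only [hrdef, hK₀, hcdef, mul_comm] using h1
  have hrK : ∀ t, 0 < t → r t ≤ K₀ := fun t ht =>
    (hrle t ht.le).trans (mul_le_of_le_one_right hK₀0 (Real.exp_le_one_iff.2 (by nlinarith [hc, ht])))
  -- local integrability (continuity on `[0, ∞)`)
  have hwc : ContinuousOn w (Ici 0) := tcs_continuousOn_scalarL2Sq hθ.smooth_scalar
  have hrc : ContinuousOn r (Ici 0) := tcs_continuousOn_scalarL2Sq hR.smooth_scalar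
  have hIoc : ∀ {f : ℝ → ℝ}, ContinuousOn f (Ici 0) → ∀ T, 0 < T → IntegrableOn f (Ioc 0 T) :=
    fun hf T _ => ((hf.mono Icc_subset_Ici_self).integrableOn_Icc (a := 0) (b := T)).mono_set
      Ioc_subset_Icc_self
  -- bounded running means: enstrophy (Leray–Hopf), transient (≤ K₀), cold start (≤ 2u + 2r)
  have hLH := isGlobalLerayHopf_of_isClassicalNSSolutionOn_Ici hNS
  set Z : ℝ → ℝ := fun t => (Torus.eGradNormSq (v t)).toReal with hZdef
  have hZ0 : ∀ t, 0 ≤ Z t := fun t => ENNReal.toReal_nonneg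
  have hZu : ∀ t, 0 < t → u t = Z t := fun t ht =>
    (stub_planarCurlTools.2 (v t) (hNS.smooth_velocity.isSmooth_slice (mem_Ici.2 ht.le))
      (hNS.divFree t (mem_Ici.2 ht.le))).symm
  have hbZ : IsBoundedUnder (· ≤ ·) atTop (timeMean Z) := by
    -- adapted from `longTimeAvgSup_sqrt_le_sqrt_add_one`
    obtain ⟨b, hb⟩ := hLH.isBoundedUnder_timeMean_dissipation hν (hg.memLp 2) hgz
    refine ⟨b / ν, ?_⟩
    rw [eventually_map] at hb ⊢
    filter_upwards [hb] with T hT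
    rw [timeMean_const_mul] at hT
    rw [le_div_iff₀ hν]
    linarith [mul_comm ν (timeMean Z T)]
  have hZi : ∀ T, 0 < T → IntegrableOn Z (Ioc 0 T) := fun T hT0 => by
    rw [integrableOn_Ioc_iff_integrableOn_Ioo]
    exact integrable_toReal_of_lintegral_ne_top (hLH T hT0).aemeasurable_eGradNormSq
      (hLH T hT0).lintegral_eGradNormSq_lt_top.ne
  have hbu : IsBoundedUnder (· ≤ ·) atTop (timeMean u) :=
    isBoundedUnder_timeMean_of_le hZ0 hZi (fun t ht => (hZu t ht).le) hbZ
  have hbr : IsBoundedUnder (· ≤ ·) atTop (timeMean r) := tcs_isBoundedUnder_timeMean_of_le_const hK₀0 hrK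
  -- pointwise: `θ = ω - R`, so `w ≤ 2u + 2r`; and `u ≤ (1+η) w + (1+η⁻¹) r`
  have hθeq : ∀ t x, θ t x = ω t x + (-R t x) := fun t x => by simp [hRdef]
  have hωeq : ∀ t x, ω t x = θ t x + R t x := fun t x => by simp [hRdef]
  have hwle : ∀ t, 0 < t → w t ≤ 2 * u t + 2 * r t := by
    intro t ht
    have hωt : Torus.IsSmooth (ω t) := hω.smooth_scalar.isSmooth_slice (mem_Ici.2 ht.le)
    have hRt : Torus.IsSmooth (R t) := hR.smooth_scalar.isSmooth_slice (mem_Ici.2 ht.le)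
    have hRt' : Torus.IsSmooth (fun x => -R t x) := hRt.neg
    have h1 := tcs_scalarL2Sq_add_le one_pos hωt hRt'
    have eθ : θ t = fun x => ω t x + -R t x := funext (hθeq t)
    have e2 : Torus.scalarL2Sq (fun x => -R t x) = Torus.scalarL2Sq (R t) := by
      simp only [Torus.scalarL2Sq, neg_sq]
    rw [← eθ, e2, inv_one] at h1
    simp only [hudef, hwdef, hrdef]
    linarith
  have hui : ∀ T, 0 < T → IntegrableOn u (Ioc 0 T) := fun T hT =>
    (hZi T hT).congr_fun (fun t ht => (hZu t ht.1).symm) measurableSet_Ioc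
  have hbw : IsBoundedUnder (· ≤ ·) atTop (timeMean w) := by
    have hgi : ∀ T, 0 < T → IntegrableOn (fun t => 2 * u t + 2 * r t) (Ioc 0 T) := fun T hT =>
      ((hui T hT).const_mul 2).add ((hIoc hrc T hT).const_mul 2)
    refine isBoundedUnder_timeMean_of_le
      (fun t => add_nonneg (mul_nonneg zero_le_two (hu0 t)) (mul_nonneg zero_le_two (hr0 t))) hgi hwle ?_
    obtain ⟨A, hA⟩ := hbu
    obtain ⟨B, hB⟩ := hbr
    rw [eventually_map] at hA hB
    refine ⟨2 * A + 2 * B, ?_⟩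
    rw [eventually_map]
    filter_upwards [hA, hB, eventually_gt_atTop (0 : ℝ)] with T hA' hB' hT
    rw [timeMean_add hT.le ((hui T hT).const_mul 2) ((hIoc hrc T hT).const_mul 2), timeMean_const_mul,
      timeMean_const_mul]
    linarith
  -- Cesàro: `⟨u⟩ ≤ (1+η)⟨w⟩ + (1+η⁻¹)⟨r⟩` and `⟨r⟩ = 0`
  have hrmean : longTimeAvgSup r ≤ 0 := by
    refine envSrc_longTimeAvgSup_le_of_transient hr0 (fun T hT => ?_) (fun t => by positivity)
      ((exp_neg_integrableOn_Ioi 0 hc).const_mul K₀) (fun t ht => by simpa using hrle t ht)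
    exact ((hrc.mono (by rw [uIcc_of_le hT.le]; exact Icc_subset_Ici_self))).intervalIntegrable
  have hstep : ∀ η : ℝ, 0 < η → longTimeAvgSup u ≤ (1 + η) * longTimeAvgSup w := by
    intro η hη
    have hη' : 0 < 1 + η⁻¹ := by positivity
    have hle : ∀ t, 0 < t → u t ≤ (1 + η) * w t + (1 + η⁻¹) * r t := by
      intro t ht
      have hθt : Torus.IsSmooth (θ t) := hθ.smooth_scalar.isSmooth_slice (mem_Ici.2 ht.le)
      have hRt : Torus.IsSmooth (R t) := hR.smooth_scalar.isSmooth_slice (mem_Ici.2 ht.le)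
      have h1 := tcs_scalarL2Sq_add_le hη hθt hRt
      have e1 : Torus.scalarL2Sq (fun x => θ t x + R t x) = u t := by
        simp only [hudef, Torus.scalarL2Sq, hωeq]
      rwa [e1] at h1
    have h2 := longTimeAvgSup_le_add_of_le_add hu0 (fun t => mul_nonneg (by positivity) (hw0 t))
      (fun t => mul_nonneg hη'.le (hr0 t))
      (fun T hT => (hIoc hwc T hT).const_mul _) (fun T hT => (hIoc hrc T hT).const_mul _)
      (isBoundedUnder_timeMean_const_mul (by positivity) hbw)
      (isBoundedUnder_timeMean_const_mul hη'.le hbr) hle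
    rw [longTimeAvgSup_const_mul (by positivity), longTimeAvgSup_const_mul hη'.le] at h2
    nlinarith [hrmean, longTimeAvgSup_nonneg hr0]
  -- `η ↓ 0`
  have hW0 : 0 ≤ longTimeAvgSup w := longTimeAvgSup_nonneg hw0
  have hcongr : longTimeAvgSup Z = longTimeAvgSup u :=
    longTimeAvgSup_congr_of_eqOn_Ioi fun t ht => (hZu t ht).symm
  rw [hcongr]
  refine le_of_forall_pos_le_add fun ε hε => ?_
  have h := hstep (ε / (longTimeAvgSup w + 1)) (by positivity)
  have e : (1 + ε / (longTimeAvgSup w + 1)) * longTimeAvgSup w =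
      longTimeAvgSup w + ε * (longTimeAvgSup w / (longTimeAvgSup w + 1)) := by
    field_simp
  have hfrac : longTimeAvgSup w / (longTimeAvgSup w + 1) ≤ 1 := by
    rw [div_le_one (by positivity)]
    linarith
  nlinarith

/-! ## The registered stub: the family statement -/

/-- **Q6 `stub_torqueColdStartDiverges` (line `Sketch` = duhamel-release, crux `TwoAndHalfD.TwohalfdThesis`; registered
signature) — THE Pr = 1 SPLITTING: the torque cold start diverges.**  Along a family as in W (one steady smooth mean-zero
force `g`, classical planar Navier–Stokes members, classical releases of `h` from every `s ≥ 0` with a uniform integrable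
envelope after `s₀`, Green–Kubo floor `ε > 0`; neither the energy ceiling nor `ν_j → 0` is assumed) there are `κ₀ > 0`,
`a > 0`, `b` such that for every member with `ν_j ≤ κ₀` and `a·log(1/ν_j) ≥ b` and EVERY classical cold start `θ` of the
torque pattern `curl g` over it (`θ(0) = 0`): `(a·log(1/ν_j) − b)² ≤ ⟨‖θ‖²⟩`.  Contrast: the cold start of `h` over the
same flow has variance `≤ (s₀+M)²‖h‖²` (D1).  PROOF: the floor forces `h ≠ 0` (`scalarL2Sq_pos_of_gkFloor`), the
`h`-envelope has a lossy lag (`exists_lossyLag_of_envelope`), G5 `stub_witnessEnstrophyFloor` gives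
`((δ‖h‖² log/C − 1)/τ₀)² ≤ ⟨‖∇v_j‖₂²⟩`, and `enstrophy_le_torqueColdStartVariance` concludes; `a = δ‖h‖²/(Cτ₀)`,
`b = 1/τ₀`, `δ = 3/4`. [folklore] -/
theorem stub_torqueColdStartDiverges :
    ∀ (g : (UnitAddTorus (Fin 2)) → (EuclideanSpace ℝ (Fin 2))) (h : (UnitAddTorus (Fin 2)) → ℝ),
      Torus.IsSmooth g → Torus.HasZeroMean g → Torus.IsSmooth h →
      ∀ (ν : ℕ → ℝ) (v : ℕ → ℝ → (UnitAddTorus (Fin 2)) → (EuclideanSpace ℝ (Fin 2))) (p : ℕ → ℝ → (UnitAddTorus (Fin 2)) → ℝ)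
        (φ : ℕ → ℝ → ℝ → (UnitAddTorus (Fin 2)) → ℝ) (Λ : ℝ → ℝ) (s₀ ε : ℝ),
        (∀ j, 0 < ν j) →
        (∀ j, Torus.IsClassicalNSSolutionOn (Ici 0) (ν j) (fun _ => g) (v j) (p j)) →
        (∀ j s, 0 ≤ s → Torus.IsClassicalScalarTransportOn (Ici s) (ν j) (v j) (φ j s) ∧ φ j s s = h) →
        0 ≤ s₀ → (∀ τ, 0 ≤ Λ τ) → IntegrableOn Λ (Ici 0) →
        (∀ j s t, s₀ ≤ s → s ≤ t → Torus.scalarL2Sq (φ j s t) ≤ Λ (t - s) ^ 2 * Torus.scalarL2Sq h) →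
        0 < ε →
        (∀ j, ε ≤ liminf (timeMean fun t => ∫ s in (0 : ℝ)..t, ∫ x, h x * φ j s t x) atTop) →
        ∃ κ₀ a b : ℝ, 0 < κ₀ ∧ 0 < a ∧ ∀ j, ν j ≤ κ₀ → 0 ≤ a * Real.log (ν j)⁻¹ - b →
          ∀ θ : ℝ → (UnitAddTorus (Fin 2)) → ℝ,
            Torus.IsClassicalScalarTransportForcedOn (Ici 0) (ν j) (v j)
              (fun _ x => Torus.partialDeriv 0 g x 1 - Torus.partialDeriv 1 g x 0) θ →
            θ 0 = (fun _ => (0 : ℝ)) →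
            (a * Real.log (ν j)⁻¹ - b) ^ 2 ≤ longTimeAvgSup (fun t => Torus.scalarL2Sq (θ t)) := by
  intro g h hgs hgz hhs ν v p φ Λ s₀ ε hν hNS hrel hs₀ hΛ0 hΛi henv hε hGK
  -- `h ≠ 0` by the floor; a lossy lag with `δ = 3/4`
  have hh0 : 0 < Torus.scalarL2Sq h := scalarL2Sq_pos_of_gkFloor hhs hε hGK
  obtain ⟨τ₀, hτ₀, hloss⟩ := exists_lossyLag_of_envelope hh0.le hΛ0 hΛi henv
  -- G5: the mean-enstrophy floor
  obtain ⟨κ₀, C, hκ₀, -, hC, hfloor⟩ :=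
    stub_witnessEnstrophyFloor ν g v p h φ s₀ τ₀ (3 / 4) hν hgs hgz hNS hhs hτ₀ hrel hs₀ hloss
  refine ⟨κ₀, 3 / 4 * Torus.scalarL2Sq h / (C * τ₀), 1 / τ₀, hκ₀, by positivity, ?_⟩
  intro j hj hab θ hθ hθ0
  have e : 3 / 4 * Torus.scalarL2Sq h / (C * τ₀) * Real.log (ν j)⁻¹ - 1 / τ₀ =
      (3 / 4 * Torus.scalarL2Sq h * Real.log (ν j)⁻¹ / C - 1) / τ₀ := by
    field_simp
  rw [e] at hab ⊢
  have hA : 0 ≤ 3 / 4 * Torus.scalarL2Sq h * Real.log (ν j)⁻¹ / C - 1 := by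
    have := mul_nonneg hab hτ₀.le
    rwa [div_mul_cancel₀ _ hτ₀.ne'] at this
  exact (hfloor j hj hA).trans (enstrophy_le_torqueColdStartVariance (hν j) hgs hgz (hNS j) hθ hθ0)

end Summit.AnomalousDissipation.AnomalousDissipation.Theorems.TwohalfdThesis

end
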